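import Summits.BirchSwinnertonDyer.BirchSwinnertonDyer.Theses.RamifiedSevenEllipticUnits
import Summits.BirchSwinnertonDyer.Rank1Residual.X12.O11.RamifiedStrictDescent
import Summits.BirchSwinnertonDyer.Rank1Residual.X12.CMSevenAwayFromSeven
import Summits.BirchSwinnertonDyer.Rank1Residual.X11b.AnticyclotomicLocalKernelTrivial
import Summits.BirchSwinnertonDyer.Rank1Residual.X11b.AnticyclotomicLocalTorsionDescent
import Summits.BirchSwinnertonDyer.Rank1Residual.X11b.AnticyclotomicEmbedding
import Literature.NumberTheory.EllipticCurves.MazurTorsionLocalStepsProofs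
import Literature.NumberTheory.EllipticCurves.ComplexMultiplicationNotSemistable
import Literature.NumberTheory.EllipticCurves.HeegnerPointsKolyvaginGoodReductionProofs
import Literature.NumberTheory.EllipticCurves.LFunctionPrimeCoeff
import Literature.NumberTheory.EllipticCurves.TamagawaPrimesEquivProofs
import Literature.NumberTheory.QuadraticFields.KroneckerSplitting
import HarnessLib

set_option linter.dupNamespace false
set_option autoImplicit false

/-!
# Route `RamifiedSevenEllipticUnits` (rung K7r), crux `StrictControlSeven` (stmt-BirchSwinnertonDyer-19145):
# the local input AWAY from `7` — "good reduction or no `7`-torsion over `K_v`" at every `v ∤ 7` of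
# the CM field, for every `W ∈ 𝒞₇` (memo O11-RAMIFIED-DESCENT (LV1)–(LV3), in the kernel)

Cell `bsd-cm`, seat `bsd-cm-k7r-c4` (g0). HONEST FRAMING: nothing here closes the crux; BSD is not
proved by any of this. This file DISCHARGES the away-from-`p` local hypothesis of the seat's exact
control theorem (`RamifiedSevenEllipticUnitsStrictControlExactControl`,
`controlMap_bijective_of_noPTorsion`) for the class 𝒞₇ at `p = 7`; the input AT the ramified prime
(`E(K_𝔭)[7] = 0`, BKNO (3.16)) is not touched here.

## What is proved

* `noPTorsion_padic_of_not_good_of_not_mult` — for `E/ℚ` and primes `ℓ ≠ p`, `p ≥ 5`: if `E` has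
  neither good nor multiplicative reduction at `ℓ` (so the `ℤ_ℓ`-minimal model is ADDITIVE), then
  `E(ℚ_ℓ)[p] = 0` (no `ℚ_ℓ`-point of `W ⊗ ℚ_ℓ` killed by `p` other than `O`). This is Mazur's Step 1 / Silverman *ATAEC* IV.9.2(d) on the minimal model
  (`eq_zero_of_hasAdditiveReduction_of_prime_nsmul_eq_zero`: `[E(ℚ_v):E₀(ℚ_v)] ≤ 4 < p`,
  `E₀/E₁ ↪ k̄⁺` has no `p`-torsion, `E₁` neither), transported to the given equation by the variable
  change `W_min = C • (W ⊗ ℚ_ℓ)` (`VariableChange.pointEquiv`).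
* `noPTorsion_adicCompletion_of_degreeOne` — the same over `K_w` for a number field `K` and a
  degree-one place `w ∣ ℓ` (`K_w ≃ ℚ_ℓ`, `exists_ringHom_adicCompletion_padic_of_degreeOne`).
* **`good_or_noSevenTorsion_of_classCSeven`** — for a global minimal `W ∈ 𝒞₇`, an O11 frame
  `(K, 𝔭, W', C)` at `7` (so `K` is THE CM field `ℚ(√−7)`), and every finite place `v ∤ 7` of `K`:
  `W_K` has good reduction at `v` OR `W_K(K_v)[7] = 0`. At a prime `ℓ` under `v` with `W` good:
  base change of good reduction; otherwise `ℓ ≠ 2, 7` is a bad prime of a CM curve, hence ADDITIVE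
  (`not_mult_of_hasCM`) and SPLIT in `K` (the 𝒞₇ clause `CMSplit W ℓ`, i.e. `(d_K/ℓ) = 1`, turned into
  "two primes above `ℓ`" by the decomposition law `ncard_primesOver_eq_two_iff_legendreSym` and into
  `e = f = 1` by `degreeOne_of_splitsIn`), so `K_v ≃ ℚ_ℓ` and the first bullet applies.

References: [Mazur1977] Ch. III §5 Step 1 (p. 158); [SilvermanATAEC1994] Cor. IV.9.2(d);
[SilvermanAEC2009] VII.5 Prop. 5.1, VII.5.4; [GreenbergLNM1716] §3 pp. 74–75 (the use: `ker r_v = 0`);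
Marcus, *Number Fields*, Ch. 3 Thm. 25 (decomposition law).
-/

noncomputable section

open scoped Classical

open WeierstrassCurve NumberField IsDedekindDomain Field
  Literature.NumberTheory.EllipticCurves
  Literature.NumberTheory.EllipticCurves.Rank1Residual
  Literature.NumberTheory.GaloisRepresentations
  Summit.BirchSwinnertonDyer.Rank1Residual
  Summit.BirchSwinnertonDyer.Rank1Residual.X11b

namespace Summit.BirchSwinnertonDyer.BirchSwinnertonDyer.Theorems.RamifiedSevenEllipticUnits

/-! ## §1 `E(ℚ_ℓ)[p] = 0` at an additive `ℓ ≠ p`, `p ≥ 5` -/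

/-- **No `p`-torsion over `ℚ_ℓ` at an additive prime `ℓ ≠ p`, `p ≥ 5`.** For an elliptic curve
`W/ℚ` and a prime `ℓ` at which `W` has neither good nor multiplicative reduction (so the `ℤ_ℓ`-minimal
model is ADDITIVE, by trichotomy), every `ℚ_ℓ`-point of `W ⊗ ℚ_ℓ` killed by a prime `p ≥ 5`, `p ≠ ℓ`,
is `O`: Mazur's Step 1 on the minimal model (`eq_zero_of_hasAdditiveReduction_of_prime_nsmul_eq_zero`;
`[E(ℚ_ℓ):E₀] ≤ 4 < p`, `E₀/E₁ ↪ k̄⁺`, `E₁` pro-`ℓ`), transported along `W_min = C • (W ⊗ ℚ_ℓ)`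
(`VariableChange.pointEquiv`). [cite: Mazur1977, Ch. III §5 Step 1 (p. 158)] [cite: SilvermanATAEC1994, Cor. IV.9.2(d) (PDF p. 340)] -/
theorem noPTorsion_padic_of_not_good_of_not_mult (W : WeierstrassCurve ℚ) [W.IsElliptic]
    (ℓ : ℕ) [hℓ : Fact ℓ.Prime] {p : ℕ} (hp : p.Prime) (h5 : 5 ≤ p) (hℓp : ℓ ≠ p)
    (hg : ¬ Good W ℓ) (hm : ¬ Mult W ℓ) :
    ∀ R : (W.baseChange ℚ_[ℓ]).toAffine.Point, p • R = 0 → R = 0 := by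
  have hadd : ((W.baseChange ℚ_[ℓ]).minimal ℤ_[ℓ]).HasAdditiveReduction ℤ_[ℓ] := by
    rcases hasGoodReduction_or_hasMultiplicativeReduction_or_hasAdditiveReduction ℤ_[ℓ]
        (W := (W.baseChange ℚ_[ℓ]).minimal ℤ_[ℓ]) with h | h | h
    · exact absurd (show Good W ℓ from h) hg
    · exact absurd (show Mult W ℓ from h) hm
    · exact h
  haveI : ((W.baseChange ℚ_[ℓ]).minimal ℤ_[ℓ]).IsElliptic := by
    unfold minimal baseChange; infer_instance
  haveI := hadd
  haveI : Finite (IsLocalRing.ResidueField ℤ_[ℓ]) :=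
    Finite.of_equiv _ (PadicInt.residueField (p := ℓ)).symm.toEquiv
  haveI : PerfectField (IsLocalRing.ResidueField ℤ_[ℓ]) := PerfectField.ofFinite
  have hpk : (p : IsLocalRing.ResidueField ℤ_[ℓ]) ≠ 0 := by
    intro h0
    have h1 : (p : ZMod ℓ) = 0 := by
      have h := congrArg (PadicInt.residueField (p := ℓ)) h0
      rwa [map_natCast, map_zero] at h
    rw [ZMod.natCast_eq_zero_iff] at h1
    exact hℓp ((Nat.prime_dvd_prime_iff_eq hℓ.out hp).mp h1)
  have hX : ∀ P : ((W.baseChange ℚ_[ℓ]).minimal ℤ_[ℓ]).toAffine.Point, p • P = 0 → P = 0 :=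
    fun P hP ↦ eq_zero_of_hasAdditiveReduction_of_prime_nsmul_eq_zero ℤ_[ℓ] _ hp h5 hpk hP
  obtain ⟨C, hC⟩ : ∃ C : VariableChange ℚ_[ℓ],
      (W.baseChange ℚ_[ℓ]).minimal ℤ_[ℓ] = C • W.baseChange ℚ_[ℓ] := ⟨_, rfl⟩
  rw [hC] at hX
  intro R hR
  have h := hX (VariableChange.pointEquiv (W.baseChange ℚ_[ℓ]) C R)
    (by rw [← map_nsmul, hR, map_zero])
  exact (AddEquiv.map_eq_zero_iff _).mp h

/-- **… hence over `K_w` at a degree-one place `w ∣ ℓ` of a number field `K`** (`K_w ≃ ℚ_ℓ`,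
`exists_ringHom_adicCompletion_padic_of_degreeOne`; points map injectively along a ring map of
fields, `noPTorsion_baseChange_adicCompletion_of_ringHom`).
[cite: Mazur1977, Ch. III §5 Step 1 (p. 158)] [cite: SilvermanAEC2009, VII.§1] -/
theorem noPTorsion_adicCompletion_of_degreeOne {K : Type} [Field K] [NumberField K]
    (W : WeierstrassCurve ℚ) [W.IsElliptic] (ℓ : ℕ) [Fact ℓ.Prime] {p : ℕ} (hp : p.Prime)
    (h5 : 5 ≤ p) (hℓp : ℓ ≠ p) (hg : ¬ Good W ℓ) (hm : ¬ Mult W ℓ) (w : HeightOneSpectrum (𝓞 K))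
    (hℓw : ((ℓ : ℕ) : 𝓞 K) ∈ w.asIdeal) (he : w.asIdeal.ramificationIdx (𝓞 ℚ) = 1)
    (hf : w.asIdeal.inertiaDeg (𝓞 ℚ) = 1) :
    ∀ R : ((W.baseChange K).baseChange (w.adicCompletion K)).toAffine.Point, p • R = 0 → R = 0 := by
  obtain ⟨e⟩ := AcSelmer.exists_ringHom_adicCompletion_padic_of_degreeOne (p := ℓ) w hℓw he hf
  exact noPTorsion_baseChange_adicCompletion_of_ringHom W p w e
    (noPTorsion_padic_of_not_good_of_not_mult W ℓ hp h5 hℓp hg hm)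

/-! ## §2 𝒞₇: good reduction or no `7`-torsion at every `v ∤ 7` of the CM field -/

/-- **The away-from-`7` local input for 𝒞₇.** For a global minimal `W ∈ 𝒞₇`, an O11 frame
`(K, 𝔭, W', C)` of `(W, 7)` and every finite place `v ∤ 7` of `K`: `W_K` has good reduction at `v`,
or `W_K(K_v)[7] = 0`. (At the prime `ℓ` under `v`: good reduction base-changes; a bad `ℓ ≠ 7` is
`≠ 2` (`2` is good on 𝒞₇), ADDITIVE (CM) and SPLIT in `K = ℚ(√−7)` (𝒞₇ clause + decomposition law),
so `v` has degree one and §1 applies.) This is the hypothesis `hv` of the seat's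
`controlMap_bijective_of_noPTorsion` / `strictControl_frame_natCard_eq` at `p = 7`.
[cite: Mazur1977, Ch. III §5 Step 1 (p. 158)] [cite: SilvermanAEC2009, VII.5 Prop. 5.1 and Prop. 5.4] -/
theorem good_or_noSevenTorsion_of_classCSeven (W : WeierstrassCurve ℚ) [W.IsElliptic]
    [W.IsGloballyMinimal] [Fact (Nat.Prime 7)] (hC : X12.ClassCSeven W)
    {K : Type} [Field K] [NumberField K] {𝔭 : HeightOneSpectrum (𝓞 K)}
    {W' : WeierstrassCurve ℚ} {C : VariableChange ℚ} (hF : X12.O11.IsFrame W 7 K 𝔭 W' C)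
    (v : HeightOneSpectrum (𝓞 K)) (h7v : ((7 : ℕ) : 𝓞 K) ∉ v.asIdeal) :
    (W.baseChange K).HasGoodReductionAt v ∨
      ∀ R : ((W.baseChange K).baseChange (v.adicCompletion K)).toAffine.Point,
        7 • R = 0 → R = 0 := by
  -- the rational prime `ℓ` under `v`
  set v₀ : HeightOneSpectrum (𝓞 ℚ) := v.under (𝓞 ℚ) with hv₀def
  set ℓ : ℕ := (Rat.HeightOneSpectrum.primesEquiv v₀ : ℕ) with hℓdef
  haveI hℓ : Fact ℓ.Prime := ⟨(Rat.HeightOneSpectrum.primesEquiv v₀).2⟩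
  have hv₀ : v.under (𝓞 ℚ) = ratPlace ℓ := by
    rw [ratPlace, ← hv₀def]
    exact ((Rat.HeightOneSpectrum.primesEquiv (R := 𝓞 ℚ)).symm_apply_apply v₀).symm
  have hℓv : ((ℓ : ℕ) : 𝓞 K) ∈ v.asIdeal := mem_of_under_eq_ratPlace hv₀
  haveI : v.asIdeal.LiesOver v₀.asIdeal := ⟨rfl⟩
  have hℓ7 : ℓ ≠ 7 := by
    rintro h7
    rw [h7] at hℓv
    exact h7v hℓv
  by_cases hgood : Good W ℓ
  · -- good reduction base-changes to `K` at `v`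
    left
    have hgood' : W.HasGoodReductionAt v₀ :=
      (hasGoodReductionAtPrime_primesEquiv_iff_holds W v₀ ℓ rfl).mp hgood
    exact hasGoodReductionAt_baseChange_of_hasGoodReductionAt_rat W v₀ v hgood'
  · right
    -- `ℓ ≠ 2`: `2` is a good prime on 𝒞₇ (transport `Good W 2` along `primesEquiv v₀ = ℓ = 2`)
    have hℓ2 : ℓ ≠ 2 := by
      intro h2
      apply hgood
      haveI : Fact (Nat.Prime 2) := ⟨Nat.prime_two⟩
      have hg2 : W.HasGoodReductionAt v₀ :=
        (hasGoodReductionAtPrime_primesEquiv_iff_holds W v₀ 2 (by rw [← h2])).mp hC.2.2.2.1.1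
      exact (hasGoodReductionAtPrime_primesEquiv_iff_holds W v₀ ℓ rfl).mpr hg2
    -- `ℓ` is neither good nor multiplicative for the CM curve `W`
    have hmult : ¬ Mult W ℓ := not_mult_of_hasCM W hC.1 ℓ
    -- `ℓ` splits in `K = ℚ(√−7)`: the 𝒞₇ clause, read through the decomposition law
    have hsplit : CMSplit W ℓ := hC.2.2.2.2 ℓ hℓ7 hgood
    have hK2 : Module.finrank ℚ K = 2 := hF.2.2.2.1.1
    have hdisc : NumberField.discr K = cmFieldDiscrOfJ W.j := hF.2.2.2.2.1
    have hleg : legendreSym ℓ (NumberField.discr K) = 1 := by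
      rw [hdisc]
      obtain ⟨hndvd, hsq⟩ := hsplit
      rw [if_neg hℓ2] at hsq
      have h0 : ((cmFieldDiscrOfJ W.j : ℤ) : ZMod ℓ) ≠ 0 := by
        rwa [Ne, ZMod.intCast_zmod_eq_zero_iff_dvd]
      exact (legendreSym.eq_one_iff ℓ h0).mpr hsq
    have hS : SplitsIn K ℓ :=
      (Literature.NumberTheory.QuadraticFields.Quadratic.ncard_primesOver_eq_two_iff_legendreSym
        hK2 hℓ2).mpr hleg
    obtain ⟨he, hf⟩ := degreeOne_of_splitsIn hK2 hS hℓv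
    exact noPTorsion_adicCompletion_of_degreeOne W ℓ (by norm_num) (by norm_num) hℓ7 hgood hmult
      v hℓv he hf

end Summit.BirchSwinnertonDyer.BirchSwinnertonDyer.Theorems.RamifiedSevenEllipticUnits

end
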